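import Summits.ValiantsHypothesis.ValiantsHypothesis.Theorems.BarrierLeverChowBenchmarkPairsZeroOneNoGo

/-!
# Route BarrierLever — item 22038 `ChowBenchmarkPairs`, line `moore-peel`, stub `stub_zeroOneDesign` (Z01): the
# second NO-GO for 0/1 designs — a TWISTED RECTANGLE on a pair of coordinates makes the segment-moment matrix singular

Helper file (`--supports stmt-ValiantsHypothesis-22038`; cell valiant-natproofs, rung V4, 𝒟-side benchmark of record; seat
val-np-p4 gen 19; companion of `…ZeroOne` (p626042: closed form, Z01 node) and `…ZeroOneNoGo` (p629307: parallel edges); memo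
HOME/val-np-p4/g19/MEMO-zero-one-designs-valnp4-g19.md §9).  Closes NO item.

THE RULE (design rule R2 of the memo, main case).  In a 0/1 design `zoTable σ` let `u ≠ v` be two coordinates and suppose the
support family contains an ALIGNED pair `σ y = σ x ∪ {u, v}` (`u, v ∉ σ x`) and an ANTI-ALIGNED pair `σ b = σ z ∪ {v}`,
`σ c = σ z ∪ {u}` (`u, v ∉ σ z`).  Then the four pair rows satisfy `row{x,b} + row{y,c} = row{x,c} + row{y,b}`, so the
segment-moment matrix is singular at every height and for every enumeration of the rows
(`det_zoTable_eq_zero_of_twisted_rectangle`).  Zeon form: `(R_x − R_y)(R_b − R_c) = −[(y_u+y_v)R_x² + 2y_uy_vR_x³]·(y_v − y_u)R_z² = 0`.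
Entrywise (this file): the local calculus `zoPairEntry_insert_*` (how the closed-form entry `[T ⊆ A∪B]·betaSum p q m` reacts to
adding a coordinate `w` to one or both supports, according as `w ∈ T` or not) reduces the identity to Pascal's rule `betaSum_succ` on
the columns containing exactly one of `u, v`, and to a tautology on the others.

WHAT THIS IS NOT: a constraint on 0/1 witnesses of Z01 only; no stub of the line is closed; nothing on items 20172 / 19717, crux
stmt-ValiantsHypothesis-14610, or `VP` versus `VNP`.
-/

set_option linter.dupNamespace false

namespace Summit.ValiantsHypothesis.ValiantsHypothesis.Theorems.BarrierLever.ChowBenchmarkZeroOne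

open Finset
open Summit.ValiantsHypothesis.ValiantsHypothesis.Theorems.BarrierLever.MoorePeel (benchCols)

variable {h : ℕ}

/-! ## 1. Local calculus of the closed-form pair entry -/

/-- Adding to the FIRST support a coordinate absent from the column does not change the entry. -/
theorem zoPairEntry_insert_left_of_notMem (A B T : Finset (Fin h)) {w : Fin h} (hw : w ∉ T) :
    zoPairEntry (insert w A) B T = zoPairEntry A B T := by
  classical
  unfold zoPairEntry
  have e : (T ⊆ insert w A ∪ B) ↔ T ⊆ A ∪ B := by
    rw [Finset.insert_union, Finset.subset_insert_iff_of_notMem hw]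
  by_cases h0 : T ⊆ A ∪ B
  · rw [if_pos (e.mpr h0), if_pos h0, Finset.sdiff_insert_of_notMem hw, Finset.inter_insert_of_notMem hw]
  · rw [if_neg (fun h' => h0 (e.mp h')), if_neg h0]

/-- Adding to the SECOND support a coordinate absent from the column does not change the entry. -/
theorem zoPairEntry_insert_right_of_notMem (A B T : Finset (Fin h)) {w : Fin h} (hw : w ∉ T) :
    zoPairEntry A (insert w B) T = zoPairEntry A B T := by
  classical
  unfold zoPairEntry
  have n' : w ∉ T ∩ A := fun hu => hw (Finset.mem_inter.mp hu).1
  have e : (T ⊆ A ∪ insert w B) ↔ T ⊆ A ∪ B := by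
    rw [Finset.union_insert, Finset.subset_insert_iff_of_notMem hw]
  by_cases h0 : T ⊆ A ∪ B
  · rw [if_pos (e.mpr h0), if_pos h0, Finset.sdiff_insert_of_notMem hw, Finset.inter_insert_of_notMem n']
  · rw [if_neg (fun h' => h0 (e.mp h')), if_neg h0]

/-- A column containing a coordinate outside both supports has entry `0`. -/
theorem zoPairEntry_eq_zero_of_mem (A B T : Finset (Fin h)) {w : Fin h} (hw : w ∈ T) (hA : w ∉ A) (hB : w ∉ B) :
    zoPairEntry A B T = 0 := by
  unfold zoPairEntry
  rw [if_neg]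
  intro hs
  rcases Finset.mem_union.mp (hs hw) with h1 | h2
  · exact hA h1
  · exact hB h2

/-- The containment condition after inserting `w` (absent from `T₀, A, B`) into the column and into at least one support. -/
theorem insert_subset_union_iff (A B T₀ : Finset (Fin h)) {w : Fin h} (hT : w ∉ T₀) (A' B' : Finset (Fin h))
    (hA' : A' = A ∨ A' = insert w A) (hB' : B' = B ∨ B' = insert w B) (hw : w ∈ A' ∪ B') :
    insert w T₀ ⊆ A' ∪ B' ↔ T₀ ⊆ A ∪ B := by
  have sub : A ∪ B ⊆ A' ∪ B' := by
    intro c hc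
    rcases Finset.mem_union.mp hc with h1 | h2
    · refine Finset.mem_union.mpr (Or.inl ?_)
      rcases hA' with rfl | rfl
      · exact h1
      · exact Finset.mem_insert_of_mem h1
    · refine Finset.mem_union.mpr (Or.inr ?_)
      rcases hB' with rfl | rfl
      · exact h2
      · exact Finset.mem_insert_of_mem h2
  have sub' : A' ∪ B' ⊆ insert w (A ∪ B) := by
    intro c hc
    rcases Finset.mem_union.mp hc with h1 | h2
    · rcases hA' with rfl | rfl
      · exact Finset.mem_insert_of_mem (Finset.mem_union.mpr (Or.inl h1))
      · rcases Finset.mem_insert.mp h1 with rfl | h1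
        · exact Finset.mem_insert_self _ _
        · exact Finset.mem_insert_of_mem (Finset.mem_union.mpr (Or.inl h1))
    · rcases hB' with rfl | rfl
      · exact Finset.mem_insert_of_mem (Finset.mem_union.mpr (Or.inr h2))
      · rcases Finset.mem_insert.mp h2 with rfl | h2
        · exact Finset.mem_insert_self _ _
        · exact Finset.mem_insert_of_mem (Finset.mem_union.mpr (Or.inr h2))
  constructor
  · intro hs c hc
    have := sub' (hs (Finset.mem_insert_of_mem hc))
    rcases Finset.mem_insert.mp this with rfl | h'
    · exact absurd hc hT
    · exact h'
  · intro hs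
    exact Finset.insert_subset_iff.mpr ⟨hw, fun c hc => sub (hs hc)⟩

/-- `w ∈ T`, `w` in the FIRST support only: `p ↦ p + 1`. -/
theorem zoPairEntry_insert_left (A B T₀ : Finset (Fin h)) {w : Fin h} (hT : w ∉ T₀) (_hA : w ∉ A) (hB : w ∉ B) :
    zoPairEntry (insert w A) B (insert w T₀) =
      if T₀ ⊆ A ∪ B then betaSum ((T₀ \ B).card + 1) (T₀ \ A).card (T₀ ∩ A ∩ B).card else 0 := by
  classical
  unfold zoPairEntry
  have e := insert_subset_union_iff A B T₀ hT (insert w A) B (Or.inr rfl) (Or.inl rfl)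
    (Finset.mem_union.mpr (Or.inl (Finset.mem_insert_self _ _)))
  by_cases h0 : T₀ ⊆ A ∪ B
  · rw [if_pos (e.mpr h0), if_pos h0]
    have e1 : insert w T₀ \ B = insert w (T₀ \ B) := Finset.insert_sdiff_of_notMem _ hB
    have e2 : insert w T₀ \ insert w A = T₀ \ A := by
      rw [Finset.insert_sdiff_of_mem _ (Finset.mem_insert_self w A), Finset.sdiff_insert_of_notMem hT]
    have e3 : insert w T₀ ∩ insert w A ∩ B = T₀ ∩ A ∩ B := by
      rw [← Finset.insert_inter_distrib, Finset.insert_inter_of_notMem hB]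
    have n1 : w ∉ T₀ \ B := fun hu => hT (Finset.mem_sdiff.mp hu).1
    rw [e1, e2, e3, Finset.card_insert_of_notMem n1]
  · rw [if_neg (fun h' => h0 (e.mp h')), if_neg h0]

/-- `w ∈ T`, `w` in the SECOND support only: `q ↦ q + 1`. -/
theorem zoPairEntry_insert_right (A B T₀ : Finset (Fin h)) {w : Fin h} (hT : w ∉ T₀) (hA : w ∉ A) (_hB : w ∉ B) :
    zoPairEntry A (insert w B) (insert w T₀) =
      if T₀ ⊆ A ∪ B then betaSum (T₀ \ B).card ((T₀ \ A).card + 1) (T₀ ∩ A ∩ B).card else 0 := by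
  classical
  unfold zoPairEntry
  have e := insert_subset_union_iff A B T₀ hT A (insert w B) (Or.inl rfl) (Or.inr rfl)
    (Finset.mem_union.mpr (Or.inr (Finset.mem_insert_self _ _)))
  by_cases h0 : T₀ ⊆ A ∪ B
  · rw [if_pos (e.mpr h0), if_pos h0]
    have e1 : insert w T₀ \ insert w B = T₀ \ B := by
      rw [Finset.insert_sdiff_of_mem _ (Finset.mem_insert_self w B), Finset.sdiff_insert_of_notMem hT]
    have e2 : insert w T₀ \ A = insert w (T₀ \ A) := Finset.insert_sdiff_of_notMem _ hA
    have e3 : insert w T₀ ∩ A ∩ insert w B = T₀ ∩ A ∩ B := by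
      rw [Finset.insert_inter_of_notMem hA]
      exact Finset.inter_insert_of_notMem (fun hu => hA (Finset.mem_inter.mp hu).2)
    have n1 : w ∉ T₀ \ A := fun hu => hT (Finset.mem_sdiff.mp hu).1
    rw [e1, e2, e3, Finset.card_insert_of_notMem n1]
  · rw [if_neg (fun h' => h0 (e.mp h')), if_neg h0]

/-- `w ∈ T`, `w` in BOTH supports: `m ↦ m + 1`. -/
theorem zoPairEntry_insert_both (A B T₀ : Finset (Fin h)) {w : Fin h} (hT : w ∉ T₀) (_hA : w ∉ A) (_hB : w ∉ B) :
    zoPairEntry (insert w A) (insert w B) (insert w T₀) =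
      if T₀ ⊆ A ∪ B then betaSum (T₀ \ B).card (T₀ \ A).card ((T₀ ∩ A ∩ B).card + 1) else 0 := by
  classical
  unfold zoPairEntry
  have e := insert_subset_union_iff A B T₀ hT (insert w A) (insert w B) (Or.inr rfl) (Or.inr rfl)
    (Finset.mem_union.mpr (Or.inl (Finset.mem_insert_self _ _)))
  by_cases h0 : T₀ ⊆ A ∪ B
  · rw [if_pos (e.mpr h0), if_pos h0]
    have e1 : insert w T₀ \ insert w B = T₀ \ B := by
      rw [Finset.insert_sdiff_of_mem _ (Finset.mem_insert_self w B), Finset.sdiff_insert_of_notMem hT]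
    have e2 : insert w T₀ \ insert w A = T₀ \ A := by
      rw [Finset.insert_sdiff_of_mem _ (Finset.mem_insert_self w A), Finset.sdiff_insert_of_notMem hT]
    have e3 : insert w T₀ ∩ insert w A ∩ insert w B = insert w (T₀ ∩ A ∩ B) := by
      rw [← Finset.insert_inter_distrib, ← Finset.insert_inter_distrib]
    have n1 : w ∉ T₀ ∩ A ∩ B := fun hu => hT (Finset.mem_inter.mp (Finset.mem_inter.mp hu).1).1
    rw [e1, e2, e3, Finset.card_insert_of_notMem n1]
  · rw [if_neg (fun h' => h0 (e.mp h')), if_neg h0]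

/-! ## 2. The twisted-rectangle identity and the no-go -/

/-- **The twisted-rectangle identity.**  For `u ≠ v`, `u, v ∉ X`, `u, v ∉ Z`, at every column `T`:
`E(X, Z+v) + E(X+u+v, Z+u) = E(X, Z+u) + E(X+u+v, Z+v)`. -/
theorem zoPairEntry_twisted (X Z T : Finset (Fin h)) (u v : Fin h) (huv : u ≠ v)
    (huX : u ∉ X) (hvX : v ∉ X) (huZ : u ∉ Z) (hvZ : v ∉ Z) :
    zoPairEntry X (insert v Z) T + zoPairEntry (insert u (insert v X)) (insert u Z) T =
      zoPairEntry X (insert u Z) T + zoPairEntry (insert u (insert v X)) (insert v Z) T := by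
  classical
  have hvuZ : v ∉ insert u Z := fun hm => (Finset.mem_insert.mp hm).elim (fun e => huv e.symm) hvZ
  have huvZ : u ∉ insert v Z := fun hm => (Finset.mem_insert.mp hm).elim huv huZ
  have huvX : u ∉ insert v X := fun hm => (Finset.mem_insert.mp hm).elim huv huX
  by_cases huT : u ∈ T
  · obtain ⟨T₁, huT₁, rfl⟩ : ∃ T₁ : Finset (Fin h), u ∉ T₁ ∧ T = insert u T₁ :=
      ⟨T.erase u, Finset.notMem_erase u T, (Finset.insert_erase huT).symm⟩
    by_cases hvT : v ∈ T₁
    · -- `u, v ∈ T`: the two `X`-rows vanish, the two `X+u+v`-rows coincide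
      obtain ⟨T₀, hvT₀, rfl⟩ : ∃ T₀ : Finset (Fin h), v ∉ T₀ ∧ T₁ = insert v T₀ :=
        ⟨T₁.erase v, Finset.notMem_erase v T₁, (Finset.insert_erase hvT).symm⟩
      have huT₀ : u ∉ T₀ := fun hm => huT₁ (Finset.mem_insert_of_mem hm)
      rw [zoPairEntry_eq_zero_of_mem X (insert v Z) _ (Finset.mem_insert_self u _) huX huvZ,
        zoPairEntry_eq_zero_of_mem X (insert u Z) _
          (Finset.mem_insert_of_mem (Finset.mem_insert_self v T₀)) hvX hvuZ, zero_add, zero_add]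
      -- both remaining entries: insert `u` into column/left/right… reduce with the calculus
      rw [zoPairEntry_insert_both (insert v X) Z (insert v T₀)
          (fun hm => (Finset.mem_insert.mp hm).elim huv huT₀) huvX huZ]
      rw [Finset.insert_comm u v X, Finset.insert_comm u v T₀,
        zoPairEntry_insert_both (insert u X) Z (insert u T₀)
          (fun hm => (Finset.mem_insert.mp hm).elim (fun e => huv e.symm) hvT₀)
          (fun hm => (Finset.mem_insert.mp hm).elim (fun e => huv e.symm) hvX) hvZ]
      -- now `E(X+v, Z)(T₀+v)` versus `E(X+u, Z)(T₀+u)` data: both are `insert_left`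
      have ev := insert_subset_union_iff X Z T₀ hvT₀ (insert v X) Z (Or.inr rfl) (Or.inl rfl)
          (Finset.mem_union.mpr (Or.inl (Finset.mem_insert_self _ _)))
      have eu := insert_subset_union_iff X Z T₀ huT₀ (insert u X) Z (Or.inr rfl) (Or.inl rfl)
          (Finset.mem_union.mpr (Or.inl (Finset.mem_insert_self _ _)))
      have a1 : insert v T₀ \ Z = insert v (T₀ \ Z) := Finset.insert_sdiff_of_notMem _ hvZ
      have a2 : insert u T₀ \ Z = insert u (T₀ \ Z) := Finset.insert_sdiff_of_notMem _ huZ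
      have a3 : insert v T₀ \ insert v X = T₀ \ X := by
        rw [Finset.insert_sdiff_of_mem _ (Finset.mem_insert_self v X), Finset.sdiff_insert_of_notMem hvT₀]
      have a4 : insert u T₀ \ insert u X = T₀ \ X := by
        rw [Finset.insert_sdiff_of_mem _ (Finset.mem_insert_self u X), Finset.sdiff_insert_of_notMem huT₀]
      have a5 : insert v T₀ ∩ insert v X ∩ Z = T₀ ∩ X ∩ Z := by
        rw [← Finset.insert_inter_distrib, Finset.insert_inter_of_notMem hvZ]
      have a6 : insert u T₀ ∩ insert u X ∩ Z = T₀ ∩ X ∩ Z := by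
        rw [← Finset.insert_inter_distrib, Finset.insert_inter_of_notMem huZ]
      have n1 : v ∉ T₀ \ Z := fun hm => hvT₀ (Finset.mem_sdiff.mp hm).1
      have n2 : u ∉ T₀ \ Z := fun hm => huT₀ (Finset.mem_sdiff.mp hm).1
      by_cases h0 : T₀ ⊆ X ∪ Z
      · rw [if_pos (ev.mpr h0), if_pos (eu.mpr h0), a1, a2, a3, a4, a5, a6, Finset.card_insert_of_notMem n1,
          Finset.card_insert_of_notMem n2]
      · rw [if_neg (fun h' => h0 (ev.mp h')), if_neg (fun h' => h0 (eu.mp h'))]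
    · -- `u ∈ T`, `v ∉ T`
      have hvT : v ∉ insert u T₁ := fun hm => (Finset.mem_insert.mp hm).elim (fun e => huv e.symm) hvT
      rw [zoPairEntry_insert_right_of_notMem X Z _ hvT,
        zoPairEntry_eq_zero_of_mem X Z _ (Finset.mem_insert_self u _) huX huZ, zero_add]
      -- E(X+u+v, Z+u)(T) = E(X+u, Z+u)(T) (v ∉ T) = insert_both
      rw [show insert u (insert v X) = insert v (insert u X) from Finset.insert_comm u v X,
        zoPairEntry_insert_left_of_notMem (insert u X) (insert u Z) _ hvT,
        zoPairEntry_insert_both X Z T₁ huT₁ huX huZ]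
      -- E(X, Z+u)(T) = insert_right
      rw [zoPairEntry_insert_right X Z T₁ huT₁ huX huZ]
      -- E(X+u+v, Z+v)(T) = E(X+u, Z)(T) (v ∉ T twice) = insert_left
      rw [zoPairEntry_insert_left_of_notMem (insert u X) (insert v Z) _ hvT,
        zoPairEntry_insert_right_of_notMem (insert u X) Z _ hvT,
        zoPairEntry_insert_left X Z T₁ huT₁ huX huZ]
      by_cases h0 : T₁ ⊆ X ∪ Z
      · simp only [if_pos h0]
        rw [betaSum_succ]
      · simp only [if_neg h0]
  · by_cases hvT : v ∈ T
    · -- `v ∈ T`, `u ∉ T`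
      obtain ⟨T₀, hvT₀, rfl⟩ : ∃ T₀ : Finset (Fin h), v ∉ T₀ ∧ T = insert v T₀ :=
        ⟨T.erase v, Finset.notMem_erase v T, (Finset.insert_erase hvT).symm⟩
      -- E(X, Z+v)(T) = insert_right
      rw [zoPairEntry_insert_right X Z T₀ hvT₀ hvX hvZ]
      -- E(X+u+v, Z+u)(T) = E(X+v, Z)(T) (u ∉ T) = insert_left
      rw [zoPairEntry_insert_left_of_notMem (insert v X) (insert u Z) _ huT,
        zoPairEntry_insert_right_of_notMem (insert v X) Z _ huT,
        zoPairEntry_insert_left X Z T₀ hvT₀ hvX hvZ]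
      -- E(X, Z+u)(T) = E(X,Z)(T) = 0 (v ∈ T outside both)
      rw [zoPairEntry_insert_right_of_notMem X Z _ huT,
        zoPairEntry_eq_zero_of_mem X Z _ (Finset.mem_insert_self v _) hvX hvZ, zero_add]
      -- E(X+u+v, Z+v)(T) = E(X+v, Z+v)(T) = insert_both
      rw [zoPairEntry_insert_left_of_notMem (insert v X) (insert v Z) _ huT,
        zoPairEntry_insert_both X Z T₀ hvT₀ hvX hvZ]
      by_cases h0 : T₀ ⊆ X ∪ Z
      · simp only [if_pos h0]
        rw [betaSum_succ]
      · simp only [if_neg h0]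
    · -- `u, v ∉ T`: all four entries equal `E(X, Z)(T)`
      rw [zoPairEntry_insert_right_of_notMem X Z _ hvT, zoPairEntry_insert_right_of_notMem X Z _ huT,
        zoPairEntry_insert_left_of_notMem (insert v X) (insert u Z) _ huT,
        zoPairEntry_insert_left_of_notMem X (insert u Z) _ hvT,
        zoPairEntry_insert_right_of_notMem X Z _ huT,
        zoPairEntry_insert_left_of_notMem (insert v X) (insert v Z) _ huT,
        zoPairEntry_insert_left_of_notMem X (insert v Z) _ hvT,
        zoPairEntry_insert_right_of_notMem X Z _ hvT]

/-- **A twisted rectangle kills a 0/1 design.**  If `σ y = σ x ∪ {u,v}` (`u ≠ v`, both absent from `σ x`) and `σ b = σ z ∪ {v}`,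
`σ c = σ z ∪ {u}` (both absent from `σ z`) for points with `x, y` different from `b, c`, then for every enumeration `uu` of the rows
hitting all subsets of size `≤ 2` the segment-moment matrix at `zoTable σ` has determinant `0` (rows `{x,b}+{y,c} = {x,c}+{y,b}`). -/
theorem det_zoTable_eq_zero_of_twisted_rectangle (σ : Fin h → Finset (Fin h)) (x y z b c u v : Fin h) (huv : u ≠ v)
    (hy : σ y = insert u (insert v (σ x))) (hux : u ∉ σ x) (hvx : v ∉ σ x)
    (hb : σ b = insert v (σ z)) (hc : σ c = insert u (σ z)) (huz : u ∉ σ z) (hvz : v ∉ σ z)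
    (hxb : x ≠ b) (hxc : x ≠ c) (hyb : y ≠ b) (hyc : y ≠ c)
    (r : ℕ) (uu : Fin r → Finset (Fin h))
    (hsurj : ∀ S : Finset (Fin h), S.card ≤ 2 → ∃ i, uu i = S) :
    (Matrix.of fun i j : Fin r =>
      ∑ g : (↥(benchCols h r j) → ↥(uu i)), (∏ c : ↥(benchCols h r j), zoTable σ (g c) c) *
        ∏ a : ↥(uu i),
          ((Finset.univ.filter fun c : ↥(benchCols h r j) => g c = a).card.factorial : ℂ)).det = 0 := by
  classical
  have hxy : x ≠ y := by
    rintro rfl; rw [hy] at hux; exact hux (Finset.mem_insert_self _ _)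
  have hbc : b ≠ c := by
    rintro rfl; rw [hb] at hc
    have : u ∈ insert v (σ z) := by rw [hc]; exact Finset.mem_insert_self _ _
    rcases Finset.mem_insert.mp this with e | e
    · exact huv e
    · exact huz e
  set M : Matrix (Fin r) (Fin r) ℂ := Matrix.of fun i j : Fin r =>
      ∑ g : (↥(benchCols h r j) → ↥(uu i)), (∏ c : ↥(benchCols h r j), zoTable σ (g c) c) *
        ∏ a : ↥(uu i),
          ((Finset.univ.filter fun c : ↥(benchCols h r j) => g c = a).card.factorial : ℂ) with hM
  have card2 : ∀ p q : Fin h, p ≠ q → ({p, q} : Finset (Fin h)).card ≤ 2 := fun p q hpq => by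
    rw [Finset.card_pair hpq]
  obtain ⟨i₁, hi₁⟩ := hsurj {x, b} (card2 x b hxb)
  obtain ⟨i₂, hi₂⟩ := hsurj {y, c} (card2 y c hyc)
  obtain ⟨i₃, hi₃⟩ := hsurj {x, c} (card2 x c hxc)
  obtain ⟨i₄, hi₄⟩ := hsurj {y, b} (card2 y b hyb)
  have rowval : ∀ (i : Fin r) (p q : Fin h), p ≠ q → uu i = {p, q} → ∀ j : Fin r,
      M i j = (zoPairEntry (σ p) (σ q) (benchCols h r j) : ℂ) := by
    intro i p q hpq hi j
    simp only [hM, Matrix.of_apply]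
    rw [hi, segSum_pair_zoTable σ p q hpq (benchCols h r j)]
    unfold zoPairEntry
    split_ifs <;> simp
  have pair_ne : ∀ p q p' q' : Fin h, ({p, q} : Finset (Fin h)) = {p', q'} → (p = p' ∧ q = q') ∨ (p = q' ∧ q = p') := by
    intro p q p' q' e
    have hp : p ∈ ({p', q'} : Finset (Fin h)) := by rw [← e]; simp
    have hq : q ∈ ({p', q'} : Finset (Fin h)) := by rw [← e]; simp
    have hp' : p' ∈ ({p, q} : Finset (Fin h)) := by rw [e]; simp
    have hq' : q' ∈ ({p, q} : Finset (Fin h)) := by rw [e]; simp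
    simp only [Finset.mem_insert, Finset.mem_singleton] at hp hq hp' hq'
    rcases hp with rfl | rfl
    · rcases hq with rfl | rfl
      · rcases hq' with h1 | h1 <;> exact Or.inl ⟨rfl, h1.symm⟩
      · exact Or.inl ⟨rfl, rfl⟩
    · rcases hq with rfl | rfl
      · exact Or.inr ⟨rfl, rfl⟩
      · rcases hp' with h1 | h1 <;> exact Or.inr ⟨rfl, h1.symm⟩
  have n12 : i₁ ≠ i₂ := by
    intro e; rcases pair_ne x b y c (by rw [← hi₁, ← hi₂, e]) with ⟨h1, _⟩ | ⟨h1, _⟩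
    · exact hxy h1
    · exact hxc h1
  have n13 : i₁ ≠ i₃ := by
    intro e; rcases pair_ne x b x c (by rw [← hi₁, ← hi₃, e]) with ⟨_, h2⟩ | ⟨h1, _⟩
    · exact hbc h2
    · exact hxc h1
  have n14 : i₁ ≠ i₄ := by
    intro e; rcases pair_ne x b y b (by rw [← hi₁, ← hi₄, e]) with ⟨h1, _⟩ | ⟨h1, _⟩
    · exact hxy h1
    · exact hxb h1
  let w : Fin r → ℂ := Pi.single i₁ 1 + Pi.single i₂ 1 - Pi.single i₃ 1 - Pi.single i₄ 1
  have hw0 : w ≠ 0 := by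
    intro hw
    have := congr_fun hw i₁
    simp only [w, Pi.add_apply, Pi.sub_apply, Pi.single_eq_same, Pi.single_eq_of_ne n12, Pi.single_eq_of_ne n13,
      Pi.single_eq_of_ne n14, Pi.zero_apply] at this
    norm_num at this
  have hwM : Matrix.vecMul w M = 0 := by
    funext j
    simp only [w, Matrix.add_vecMul, Matrix.sub_vecMul, Matrix.single_one_vecMul, Pi.add_apply, Pi.sub_apply,
      Matrix.row_apply, Pi.zero_apply]
    rw [rowval i₁ x b hxb hi₁ j, rowval i₂ y c hyc hi₂ j, rowval i₃ x c hxc hi₃ j, rowval i₄ y b hyb hi₄ j,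
      hy, hb, hc]
    have key := zoPairEntry_twisted (σ x) (σ z) (benchCols h r j) u v huv hux hvx huz hvz
    have key' : (zoPairEntry (σ x) (insert v (σ z)) (benchCols h r j) : ℂ) +
        (zoPairEntry (insert u (insert v (σ x))) (insert u (σ z)) (benchCols h r j) : ℂ) =
        (zoPairEntry (σ x) (insert u (σ z)) (benchCols h r j) : ℂ) +
          (zoPairEntry (insert u (insert v (σ x))) (insert v (σ z)) (benchCols h r j) : ℂ) := by
      exact_mod_cast key
    linear_combination key'
  exact (Matrix.exists_vecMul_eq_zero_iff).mp ⟨w, hw0, hwM⟩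

end Summit.ValiantsHypothesis.ValiantsHypothesis.Theorems.BarrierLever.ChowBenchmarkZeroOne
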